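import Summits.HodgeConjecture.HodgeConjecture.Theorems.F0D6CmCurveBodyS2Probe   -- ★ previous part of the same Lines workfile `D6CmCurveBody` (size-lint split ×6)
import HarnessLib

/-!
# `F0D6CmCurveBodyStubShapes` — ★ RE-HOME of `Lines/D6CmCurveBody.lean`, PART 5 of 6 (size-lint split; cut at a top-level declaration boundary).

See PART 1 `Theorems/F0D6CmCurveBodyHonest.lean` for the full re-home header and the original module docstring (verbatim there). Namespaces KEPT
(re-opened below exactly as they stand at the cut, with their `open` lines); code bytes = the workfile՚s, docstrings included; options preamble repeated from PART 1.
HC_CM is proved only modulo the 7 printed citations (2 remaining: hLiu418 = stmt-HodgeConjecture-24832, h413 = stmt-HodgeConjecture-24833) until rung 0 closes; a re-home is count-neutral. -/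

noncomputable section

open scoped TensorProduct NumberField
open NumberField IsDedekindDomain Filter
open Literature.NumberTheory.GaloisRepresentations
open Literature.NumberTheory.Automorphic
open Literature.NumberTheory.Automorphic.Liu2021.AppendixC
open scoped TensorProduct Matrix NumberField Kronecker ComplexOrder
open NumberField NumberField.InfinitePlace IsDedekindDomain
open Summit.HodgeConjecture.CorCM.Model Summit.HodgeConjecture.CorCM.Model.HComp Summit.HodgeConjecture.CorCM.HComp
open Literature.AlgebraicGeometry.Motives (CMType)
open Literature.AlgebraicGeometry.ShimuraVarieties.UnitaryCanonicalModel
open Literature.NumberTheory.Automorphic Literature.NumberTheory.Automorphic.UnitaryGroup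
open Literature.NumberTheory.Automorphic.IdeleClassGroup Literature.NumberTheory.Automorphic.Liu2021 Literature.NumberTheory.Automorphic.Liu2021.AppendixC
open Literature.NumberTheory.GaloisRepresentations Literature.RepresentationTheory.Liu2021 Literature.RepresentationTheory.HarrisKudlaSweet1996
open Literature.AlgebraicGeometry.Liu2021 (IsAdmissibleElement)
open Literature.NumberTheory.Weil1964 Literature.NumberTheory.GelbartRogawski1991 Literature.NumberTheory.GelbartRogawski1991.UnitaryDualPair Literature.NumberTheory.GelbartRogawski1991.UnitaryDualPair.WeilCoinv
open Literature.NumberTheory.GelbartRogawski1991.UnitaryDualPair.LocalSplitting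
open Literature.NumberTheory.Automorphic.Liu2021.Def411WeilCarriersDoubling
open Literature.NumberTheory.Automorphic.Liu2021.Def411WeilCarriers (TW JW JW_eq isSymm_TW isUnit_det_TW Rep Eps epsOf Chi rhoVAtLine)


set_option autoImplicit false

noncomputable section

open CategoryTheory NumberField
open scoped TensorProduct
open Literature.AlgebraicGeometry.Motives
open Literature.AlgebraicGeometry.Motives.AbelianVariety (rationalTateModuleMap rationalTateAction image toImage)

-- top-level `open`/option lines of the workfile in force at this cut (replayed):
set_option autoImplicit false
open CategoryTheory NumberField
open scoped TensorProduct
open Literature.AlgebraicGeometry.Motives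
open Literature.AlgebraicGeometry.Motives.AbelianVariety (rationalTateModuleMap rationalTateAction image toImage)
open scoped TensorProduct Matrix NumberField Kronecker ComplexOrder
open NumberField NumberField.InfinitePlace IsDedekindDomain
open Summit.HodgeConjecture.CorCM.Model Summit.HodgeConjecture.CorCM.Model.HComp Summit.HodgeConjecture.CorCM.HComp
open Literature.AlgebraicGeometry.Motives (CMType)
open Literature.AlgebraicGeometry.ShimuraVarieties.UnitaryCanonicalModel
open Literature.NumberTheory.Automorphic Literature.NumberTheory.Automorphic.UnitaryGroup
open Literature.NumberTheory.Automorphic.IdeleClassGroup Literature.NumberTheory.Automorphic.Liu2021 Literature.NumberTheory.Automorphic.Liu2021.AppendixC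
open Literature.NumberTheory.GaloisRepresentations Literature.RepresentationTheory.Liu2021 Literature.RepresentationTheory.HarrisKudlaSweet1996
open Literature.AlgebraicGeometry.Liu2021 (IsAdmissibleElement)
open Literature.NumberTheory.Weil1964 Literature.NumberTheory.GelbartRogawski1991 Literature.NumberTheory.GelbartRogawski1991.UnitaryDualPair Literature.NumberTheory.GelbartRogawski1991.UnitaryDualPair.WeilCoinv
open Literature.NumberTheory.GelbartRogawski1991.UnitaryDualPair.LocalSplitting
open Literature.NumberTheory.Automorphic.Liu2021.Def411WeilCarriersDoubling
open Literature.NumberTheory.Automorphic.Liu2021.Def411WeilCarriers (TW JW JW_eq isSymm_TW isUnit_det_TW Rep Eps epsOf Chi rhoVAtLine)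

/-! ## Part K — THE FOUR STUB SHAPES OF THE NEXT-RUN REGISTRATION (A-p11 (g12), v9): `stub_S2′` ↦ {`stub_IrrOrZeroOmegaStar`, `stub_S1cSigma`,
`stub_RosZ` (or `stub_Ros` under road (P)), `stub_MO`} feeding `s2primeShape_of_stubShapes` — each shape quantifies over the FULL registered binder
block of `s2primeShape_of''` (house style of `S1Shape`/`S1cShape`), conclusion = the corresponding conjunct of `s2primeShape_of_socketsZ_smooth` VERBATIM. -/

namespace Summit.HodgeConjecture.CorCM.Lines.A3Liu418

open Summit.HodgeConjecture.CorCM.HypLiu418.S2prime Literature.NumberTheory.Automorphic.Liu2021.AppendixC.S2primeProbe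

/-- **S2′ input (i) — `IrrOrZeroOmegaStarShape`**: the REGISTERED d6 carrier `ω⋆` is irreducible OR ZERO in Liu՚s sense ([Liu2021, Def. 4.11 with Lem. D.1]: the
global theta/Weil carrier is a restricted tensor product of irreducible-or-zero local components; A-p13 (g19) census 1b051d9b — Mathlib
irreducibility fails on the zero branch), at every registered binder tuple. -/
def IrrOrZeroOmegaStarShape : Prop :=
  ∀ (F : CMField) [IsGalois ℚ F] (ι₁ : F →+* ℂ)
    (μ : Literature.NumberTheory.Automorphic.IdeleClassGroup (F : Type) →ₜ* Circle)
    (hμ : IdeleClassGroup.IsConjugateSymplectic (F : Type) μ)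
    (_hw : IdeleClassGroup.HasWeight (F : Type) μ 1)
    (ℓ : ℕ) [Fact ℓ.Prime] (ι' : ℂ ≃+* AlgebraicClosure ℚ_[ℓ])
    (Jstar : Matrix (Fin 2) (Fin 2) (F : Type)) (t : (F : Type)) (ht : t ≠ 0) (_hτt : 0 < (ι₁ t).re) (_hτt' : (ι₁ t).im = 0)
    (gstar : GL (Fin 2) (F : Type))
    (dJ : Fin 2 → (F : Type)) (hdJ : ∀ i, IsCMField.complexConj (F : Type) (dJ i) = dJ i) (hdJ0 : ∀ i, dJ i ≠ 0)
    (hg : formCongr ((IsCMField.complexConj (F : Type) : (F : Type) ≃ₐ[↥(maximalRealSubfield (F : Type))] (F : Type)) :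
        (F : Type) →+* (F : Type)) gstar (t • Jstar) = Matrix.diagonal dJ)
    (_hsig : (∃ Tstar : GL (Fin 2) ℂ,
        formCongr (starRingEnd ℂ) Tstar ((Matrix.diagonal dJ).map ι₁) = Matrix.diagonal ![(1 : ℂ), -1]) ∧
      ∀ τ' : (F : Type) →+* ℂ, InfinitePlace.mk τ' ≠ InfinitePlace.mk ι₁ → ((Matrix.diagonal dJ).map τ').PosDef)
    (K₀ : C5.OpenCompactSubgroup ↥(finAdelic ↥(maximalRealSubfield (F : Type)) (F : Type) (IsCMField.complexConj (F : Type)) 2 Jstar))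
    (S : RecordSystemGS (F : Type) Jstar ι₁ K₀) (hU7ₛ : S.HeckeTranslateDefinedOver) (hLQ : S.IsLevelQuotient)
    (h4 : 4 ≤ Module.finrank ℚ (F : Type)) (isoₛ : ℕ → Prop)
    (r : Rep ↥(maximalRealSubfield (F : Type)) (imagUnitSq F))
    (ε : Eps ↥(maximalRealSubfield (F : Type)) (imagUnitSq F))
    (_hadm : ∃ e : (F : Type), IsAdmissibleElement (F : Type) hμ.cmType.1 e ∧
      epsOf ↥(maximalRealSubfield (F : Type)) (imagUnitSq F) (F : Type) (2 * imagUnit (F : Type))⁻¹ (-e) = ε)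
    (χ : Chi ↥(maximalRealSubfield (F : Type)) (F : Type) (IsCMField.complexConj (F : Type))),
      Literature.NumberTheory.Automorphic.Liu2021.IsIrreducibleOrZero
        ((rhoVAtLine ↥(maximalRealSubfield (F : Type)) (F : Type) (IsCMField.complexConj (F : Type)) 2
          (finProdFinEquiv : Fin 2 × Fin 1 ≃ Fin (2 * 1)) (Matrix.diagonal dJ)
          (complexConj_imagUnit F) (imagUnit_ne_zero F) (imagUnit_mul_self F) (realDiagonal_isSymm F dJ hdJ)
          (isUnit_det_realDiagonal F dJ hdJ hdJ0) (realDiagonal_map F dJ hdJ).symm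
          (hsChiGS F finProdFinEquiv dJ hdJ hdJ0
            (toHeckeCharacter (F : Type) (galConj (IsCMField.complexConj (F : Type)) μ))
            (isUnitary_toHeckeCharacter (F : Type) (galConj (IsCMField.complexConj (F : Type)) μ))
            ((isOscillatorChar_toHeckeCharacter_iff (galConj (IsCMField.complexConj (F : Type)) μ)).mpr hμ.galConj))
          (r.toFun ε) χ).comp
          (finAdelicCongr ↥(maximalRealSubfield (F : Type)) (F : Type) (IsCMField.complexConj (F : Type)) gstar ht hg).symm.toMonoidHom)

/-- **S2′ input (ii) — `S1cSigmaShape`** (S1 clause (3), `G`-LEVEL phrasing, director-reserved FACT [Liu2021, p. 133 (D.3)]): the tower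
representation `1 ⊗ rhoEt` of `𝔾(𝔸^∞)` on `ℚ̄_ℓ ⊗ H¹_ét(A_∞)` at the registered GS datum is (the restriction of) a SEMISIMPLE `ℚ̄_ℓ`-representation `σ`. -/
def S1cSigmaShape : Prop :=
  ∀ (F : CMField) [IsGalois ℚ F] (ι₁ : F →+* ℂ)
    (μ : Literature.NumberTheory.Automorphic.IdeleClassGroup (F : Type) →ₜ* Circle)
    (hμ : IdeleClassGroup.IsConjugateSymplectic (F : Type) μ)
    (_hw : IdeleClassGroup.HasWeight (F : Type) μ 1)
    (ℓ : ℕ) [Fact ℓ.Prime] (ι' : ℂ ≃+* AlgebraicClosure ℚ_[ℓ])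
    (Jstar : Matrix (Fin 2) (Fin 2) (F : Type)) (t : (F : Type)) (ht : t ≠ 0) (_hτt : 0 < (ι₁ t).re) (_hτt' : (ι₁ t).im = 0)
    (gstar : GL (Fin 2) (F : Type))
    (dJ : Fin 2 → (F : Type)) (hdJ : ∀ i, IsCMField.complexConj (F : Type) (dJ i) = dJ i) (hdJ0 : ∀ i, dJ i ≠ 0)
    (hg : formCongr ((IsCMField.complexConj (F : Type) : (F : Type) ≃ₐ[↥(maximalRealSubfield (F : Type))] (F : Type)) :
        (F : Type) →+* (F : Type)) gstar (t • Jstar) = Matrix.diagonal dJ)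
    (_hsig : (∃ Tstar : GL (Fin 2) ℂ,
        formCongr (starRingEnd ℂ) Tstar ((Matrix.diagonal dJ).map ι₁) = Matrix.diagonal ![(1 : ℂ), -1]) ∧
      ∀ τ' : (F : Type) →+* ℂ, InfinitePlace.mk τ' ≠ InfinitePlace.mk ι₁ → ((Matrix.diagonal dJ).map τ').PosDef)
    (K₀ : C5.OpenCompactSubgroup ↥(finAdelic ↥(maximalRealSubfield (F : Type)) (F : Type) (IsCMField.complexConj (F : Type)) 2 Jstar))
    (S : RecordSystemGS (F : Type) Jstar ι₁ K₀) (hU7ₛ : S.HeckeTranslateDefinedOver) (hLQ : S.IsLevelQuotient)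
    (h4 : 4 ≤ Module.finrank ℚ (F : Type)) (isoₛ : ℕ → Prop)
    (r : Rep ↥(maximalRealSubfield (F : Type)) (imagUnitSq F))
    (ε : Eps ↥(maximalRealSubfield (F : Type)) (imagUnitSq F))
    (_hadm : ∃ e : (F : Type), IsAdmissibleElement (F : Type) hμ.cmType.1 e ∧
      epsOf ↥(maximalRealSubfield (F : Type)) (imagUnitSq F) (F : Type) (2 * imagUnit (F : Type))⁻¹ (-e) = ε)
    (χ : Chi ↥(maximalRealSubfield (F : Type)) (F : Type) (IsCMField.complexConj (F : Type))),
      (∃ σ : Representation (AlgebraicClosure ℚ_[ℓ]) (sec42DataGS S h4 isoₛ).G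
          (AlgebraicClosure ℚ_[ℓ] ⊗[ℚ_[ℓ]] (sec42DataGS S h4 isoₛ).etaleH1Tower ℓ),
        (∀ g, σ g = ((etaleHeckeDatumGS S hU7ₛ hLQ h4 isoₛ ℓ).rhoEt g).baseChange (AlgebraicClosure ℚ_[ℓ])) ∧
          σ.IsSemisimpleRepresentation)

/-- **S2′ input (iv) — `RosZShape`** (the POS-socket of record `SocketRosZ`, A-plan2 (g12) 02:28:29Z; producer next run = road (P), the Rosati involution
of the canonical polarisation of `A_K` stabilises `heckeImage K`): at the registered GS Hecke translates / isogeny descent, every presentation of every centre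
block of every `heckeImage K` carries a trace-non-negative ring endomorphism. -/
def RosZShape : Prop :=
  ∀ (F : CMField) [IsGalois ℚ F] (ι₁ : F →+* ℂ)
    (μ : Literature.NumberTheory.Automorphic.IdeleClassGroup (F : Type) →ₜ* Circle)
    (hμ : IdeleClassGroup.IsConjugateSymplectic (F : Type) μ)
    (_hw : IdeleClassGroup.HasWeight (F : Type) μ 1)
    (ℓ : ℕ) [Fact ℓ.Prime] (ι' : ℂ ≃+* AlgebraicClosure ℚ_[ℓ])
    (Jstar : Matrix (Fin 2) (Fin 2) (F : Type)) (t : (F : Type)) (ht : t ≠ 0) (_hτt : 0 < (ι₁ t).re) (_hτt' : (ι₁ t).im = 0)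
    (gstar : GL (Fin 2) (F : Type))
    (dJ : Fin 2 → (F : Type)) (hdJ : ∀ i, IsCMField.complexConj (F : Type) (dJ i) = dJ i) (hdJ0 : ∀ i, dJ i ≠ 0)
    (hg : formCongr ((IsCMField.complexConj (F : Type) : (F : Type) ≃ₐ[↥(maximalRealSubfield (F : Type))] (F : Type)) :
        (F : Type) →+* (F : Type)) gstar (t • Jstar) = Matrix.diagonal dJ)
    (_hsig : (∃ Tstar : GL (Fin 2) ℂ,
        formCongr (starRingEnd ℂ) Tstar ((Matrix.diagonal dJ).map ι₁) = Matrix.diagonal ![(1 : ℂ), -1]) ∧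
      ∀ τ' : (F : Type) →+* ℂ, InfinitePlace.mk τ' ≠ InfinitePlace.mk ι₁ → ((Matrix.diagonal dJ).map τ').PosDef)
    (K₀ : C5.OpenCompactSubgroup ↥(finAdelic ↥(maximalRealSubfield (F : Type)) (F : Type) (IsCMField.complexConj (F : Type)) 2 Jstar))
    (S : RecordSystemGS (F : Type) Jstar ι₁ K₀) (hU7ₛ : S.HeckeTranslateDefinedOver) (hLQ : S.IsLevelQuotient)
    (h4 : 4 ≤ Module.finrank ℚ (F : Type)) (isoₛ : ℕ → Prop)
    (r : Rep ↥(maximalRealSubfield (F : Type)) (imagUnitSq F))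
    (ε : Eps ↥(maximalRealSubfield (F : Type)) (imagUnitSq F))
    (_hadm : ∃ e : (F : Type), IsAdmissibleElement (F : Type) hμ.cmType.1 e ∧
      epsOf ↥(maximalRealSubfield (F : Type)) (imagUnitSq F) (F : Type) (2 * imagUnit (F : Type))⁻¹ (-e) = ε)
    (χ : Chi ↥(maximalRealSubfield (F : Type)) (F : Type) (IsCMField.complexConj (F : Type))),
      SocketRosZ (sec42HeckeTranslatesGS S hU7ₛ h4 isoₛ) (isogenyDescent_GS S hU7ₛ hLQ h4 isoₛ)

/-- **Road (P) form of input (iv) — `RosShape`** (`SocketRos`: a positive anti-involution of `End⁰(A_K)` stabilising `heckeImage K`, every `K`); feeds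
`RosZShape` through ★ p757326 (`rosZShape_of_rosShape`) and, by A-p10 (g12)՚s file, the ring-level uses of S1c. -/
def RosShape : Prop :=
  ∀ (F : CMField) [IsGalois ℚ F] (ι₁ : F →+* ℂ)
    (μ : Literature.NumberTheory.Automorphic.IdeleClassGroup (F : Type) →ₜ* Circle)
    (hμ : IdeleClassGroup.IsConjugateSymplectic (F : Type) μ)
    (_hw : IdeleClassGroup.HasWeight (F : Type) μ 1)
    (ℓ : ℕ) [Fact ℓ.Prime] (ι' : ℂ ≃+* AlgebraicClosure ℚ_[ℓ])
    (Jstar : Matrix (Fin 2) (Fin 2) (F : Type)) (t : (F : Type)) (ht : t ≠ 0) (_hτt : 0 < (ι₁ t).re) (_hτt' : (ι₁ t).im = 0)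
    (gstar : GL (Fin 2) (F : Type))
    (dJ : Fin 2 → (F : Type)) (hdJ : ∀ i, IsCMField.complexConj (F : Type) (dJ i) = dJ i) (hdJ0 : ∀ i, dJ i ≠ 0)
    (hg : formCongr ((IsCMField.complexConj (F : Type) : (F : Type) ≃ₐ[↥(maximalRealSubfield (F : Type))] (F : Type)) :
        (F : Type) →+* (F : Type)) gstar (t • Jstar) = Matrix.diagonal dJ)
    (_hsig : (∃ Tstar : GL (Fin 2) ℂ,
        formCongr (starRingEnd ℂ) Tstar ((Matrix.diagonal dJ).map ι₁) = Matrix.diagonal ![(1 : ℂ), -1]) ∧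
      ∀ τ' : (F : Type) →+* ℂ, InfinitePlace.mk τ' ≠ InfinitePlace.mk ι₁ → ((Matrix.diagonal dJ).map τ').PosDef)
    (K₀ : C5.OpenCompactSubgroup ↥(finAdelic ↥(maximalRealSubfield (F : Type)) (F : Type) (IsCMField.complexConj (F : Type)) 2 Jstar))
    (S : RecordSystemGS (F : Type) Jstar ι₁ K₀) (hU7ₛ : S.HeckeTranslateDefinedOver) (hLQ : S.IsLevelQuotient)
    (h4 : 4 ≤ Module.finrank ℚ (F : Type)) (isoₛ : ℕ → Prop)
    (r : Rep ↥(maximalRealSubfield (F : Type)) (imagUnitSq F))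
    (ε : Eps ↥(maximalRealSubfield (F : Type)) (imagUnitSq F))
    (_hadm : ∃ e : (F : Type), IsAdmissibleElement (F : Type) hμ.cmType.1 e ∧
      epsOf ↥(maximalRealSubfield (F : Type)) (imagUnitSq F) (F : Type) (2 * imagUnit (F : Type))⁻¹ (-e) = ε)
    (χ : Chi ↥(maximalRealSubfield (F : Type)) (F : Type) (IsCMField.complexConj (F : Type))),
      SocketRos (sec42HeckeTranslatesGS S hU7ₛ h4 isoₛ) (isogenyDescent_GS S hU7ₛ hLQ h4 isoₛ)

/-- **S2′ input (v) — `MOShape`** (the multiplicity-one dimension identity `SocketMO` on the `ℓ`-adic block of `f ∈ Hom_G(ω⋆, ℚ̄_ℓ ⊗ H¹)`; producer A-p05 (g12)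
`exists_block_multOne`, S1 (1)-conditional), at every registered binder tuple. -/
def MOShape : Prop :=
  ∀ (F : CMField) [IsGalois ℚ F] (ι₁ : F →+* ℂ)
    (μ : Literature.NumberTheory.Automorphic.IdeleClassGroup (F : Type) →ₜ* Circle)
    (hμ : IdeleClassGroup.IsConjugateSymplectic (F : Type) μ)
    (_hw : IdeleClassGroup.HasWeight (F : Type) μ 1)
    (ℓ : ℕ) [Fact ℓ.Prime] (ι' : ℂ ≃+* AlgebraicClosure ℚ_[ℓ])
    (Jstar : Matrix (Fin 2) (Fin 2) (F : Type)) (t : (F : Type)) (ht : t ≠ 0) (_hτt : 0 < (ι₁ t).re) (_hτt' : (ι₁ t).im = 0)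
    (gstar : GL (Fin 2) (F : Type))
    (dJ : Fin 2 → (F : Type)) (hdJ : ∀ i, IsCMField.complexConj (F : Type) (dJ i) = dJ i) (hdJ0 : ∀ i, dJ i ≠ 0)
    (hg : formCongr ((IsCMField.complexConj (F : Type) : (F : Type) ≃ₐ[↥(maximalRealSubfield (F : Type))] (F : Type)) :
        (F : Type) →+* (F : Type)) gstar (t • Jstar) = Matrix.diagonal dJ)
    (_hsig : (∃ Tstar : GL (Fin 2) ℂ,
        formCongr (starRingEnd ℂ) Tstar ((Matrix.diagonal dJ).map ι₁) = Matrix.diagonal ![(1 : ℂ), -1]) ∧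
      ∀ τ' : (F : Type) →+* ℂ, InfinitePlace.mk τ' ≠ InfinitePlace.mk ι₁ → ((Matrix.diagonal dJ).map τ').PosDef)
    (K₀ : C5.OpenCompactSubgroup ↥(finAdelic ↥(maximalRealSubfield (F : Type)) (F : Type) (IsCMField.complexConj (F : Type)) 2 Jstar))
    (S : RecordSystemGS (F : Type) Jstar ι₁ K₀) (hU7ₛ : S.HeckeTranslateDefinedOver) (hLQ : S.IsLevelQuotient)
    (h4 : 4 ≤ Module.finrank ℚ (F : Type)) (isoₛ : ℕ → Prop)
    (r : Rep ↥(maximalRealSubfield (F : Type)) (imagUnitSq F))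
    (ε : Eps ↥(maximalRealSubfield (F : Type)) (imagUnitSq F))
    (_hadm : ∃ e : (F : Type), IsAdmissibleElement (F : Type) hμ.cmType.1 e ∧
      epsOf ↥(maximalRealSubfield (F : Type)) (imagUnitSq F) (F : Type) (2 * imagUnit (F : Type))⁻¹ (-e) = ε)
    (χ : Chi ↥(maximalRealSubfield (F : Type)) (F : Type) (IsCMField.complexConj (F : Type))),
      SocketMO ℓ (etaleHeckeDatumGS S hU7ₛ hLQ h4 isoₛ ℓ) ι' ((rhoVAtLine ↥(maximalRealSubfield (F : Type)) (F : Type) (IsCMField.complexConj (F : Type)) 2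
          (finProdFinEquiv : Fin 2 × Fin 1 ≃ Fin (2 * 1)) (Matrix.diagonal dJ)
          (complexConj_imagUnit F) (imagUnit_ne_zero F) (imagUnit_mul_self F) (realDiagonal_isSymm F dJ hdJ)
          (isUnit_det_realDiagonal F dJ hdJ hdJ0) (realDiagonal_map F dJ hdJ).symm
          (hsChiGS F finProdFinEquiv dJ hdJ hdJ0
            (toHeckeCharacter (F : Type) (galConj (IsCMField.complexConj (F : Type)) μ))
            (isUnitary_toHeckeCharacter (F : Type) (galConj (IsCMField.complexConj (F : Type)) μ))
            ((isOscillatorChar_toHeckeCharacter_iff (galConj (IsCMField.complexConj (F : Type)) μ)).mpr hμ.galConj))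
          (r.toFun ε) χ).comp
          (finAdelicCongr ↥(maximalRealSubfield (F : Type)) (F : Type) (IsCMField.complexConj (F : Type)) gstar ht hg).symm.toMonoidHom)
        (sec42HeckeTranslatesGS S hU7ₛ h4 isoₛ) (isogenyDescent_GS S hU7ₛ hLQ h4 isoₛ)

/-- `RosZShape` ⇐ `RosShape` (★ p757326 through `socketRosZ_of_socketRos`): the road-(P) output feeds the POS-socket of record. -/
theorem rosZShape_of_rosShape (h : RosShape) : RosZShape :=
  fun F _ ι₁ μ hμ hw ℓ _ ι' Jstar t ht hτt hτt' gstar dJ hdJ hdJ0 hg hsig K₀ S hU7ₛ hLQ h4 isoₛ r ε hadm χ =>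
    socketRosZ_of_socketRosH _ _ (socketRosH_of_socketRos _ _ (h F ι₁ μ hμ hw ℓ ι' Jstar t ht hτt hτt' gstar dJ hdJ hdJ0 hg hsig K₀ S hU7ₛ hLQ h4 isoₛ r ε hadm χ))


end Summit.HodgeConjecture.CorCM.Lines.A3Liu418

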